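import Summits.Ventures.DiscreteObjects.PP12.OrderThirteenOrbitMatrix

/-!
# PP(12), order-13 cell: the COLUMN Gram equations of the orbit matrix follow algebraically (kernel)
Framing: lottery ticket; floor = certified bounds/negative ranges.

Cell pub-namedobj (venture DiscreteObjects), target (M), designs gen 18; continues `OrderThirteenOrbitMatrix`. The row equations of the orbit matrix `C = (m_{s,t})`
of valid lift data (`om_equations`: row sums `r = p − 1`, `Σ_t m² = 2r`, `Σ_t m_{s,t} m_{s',t} = r`, column sums `r`) say `C Cᵀ = r (I + J)`, `C J = J C = r J`
(`J` = all-ones). Since `C` is square and `I + J` is invertible (`(I + J)(I − J/(N+1)) = I`), linear algebra gives the COLUMN Gram equations `Cᵀ C = r (I + J)`: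
`Σ_s m_{s,t}² = 2r` and `Σ_s m_{s,t} m_{s,t'} = r` for `t ≠ t'` (`gram_transpose`, `om_col_equations`) — the dual ('two points on one line') conditions that designs g3's
enumerator `p13om.c` prunes with, obtained here WITHOUT the dual plane. Matrix algebra over `ℚ` (`mul_eq_one_comm`). Nothing asserts any census statement.
No `sorry`, no new axioms.
-/

namespace Summit.Ventures.DiscreteObjects.PP12

open Finset Matrix

namespace LiftData

variable {N : ℕ}

/-- the all-ones matrix -/
def Jm (N : ℕ) : Matrix (Fin N) (Fin N) ℚ := Matrix.of fun _ _ => 1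

/-- entries of the all-ones matrix -/
@[simp] theorem Jm_apply (i j : Fin N) : Jm N i j = 1 := rfl

/-- `J² = N J` -/
theorem Jm_mul_Jm : Jm N * Jm N = (N : ℚ) • Jm N := by
  ext i j
  simp [Matrix.mul_apply]

/-- **`C Cᵀ = r(I+J)` with `C J = J C = r J` forces `Cᵀ C = r(I+J)`** (square matrices over `ℚ`, `r ≠ 0`) -/
theorem gram_transpose {C : Matrix (Fin N) (Fin N) ℚ} {r : ℚ} (hr : r ≠ 0) (hCC : C * Cᵀ = r • (1 + Jm N))
    (hCJ : C * Jm N = r • Jm N) (hJC : Jm N * C = r • Jm N) : Cᵀ * C = r • (1 + Jm N) := by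
  -- the inverse of `r (I + J)`
  set c : ℚ := 1 / ((N : ℚ) + 1) with hc
  set B : Matrix (Fin N) (Fin N) ℚ := r⁻¹ • (1 - c • Jm N) with hB
  have hN1 : (N : ℚ) + 1 ≠ 0 := by positivity
  have hAB : (r • (1 + Jm N)) * B = 1 := by
    rw [hB, Matrix.smul_mul, Matrix.mul_smul, smul_smul, mul_inv_cancel₀ hr, one_smul, Matrix.add_mul, Matrix.one_mul,
      Matrix.mul_sub, Matrix.mul_one, Matrix.mul_smul, Jm_mul_Jm, smul_smul]
    have e : c * (N : ℚ) = 1 - c := by rw [hc]; field_simp; ring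
    rw [e, sub_smul, one_smul]
    abel
  -- `Cᵀ B` is a right inverse of `C`, hence a left inverse
  have h1 : C * (Cᵀ * B) = 1 := by rw [← Matrix.mul_assoc, hCC, hAB]
  have h2 : (Cᵀ * B) * C = 1 := mul_eq_one_comm.1 h1
  -- `C` commutes with `B`
  have hBC : B * C = C * B := by
    rw [hB, Matrix.smul_mul, Matrix.mul_smul, Matrix.sub_mul, Matrix.mul_sub, Matrix.one_mul, Matrix.mul_one, Matrix.smul_mul, Matrix.mul_smul, hJC, hCJ]
  -- conclude
  have h3 : Cᵀ * C * B = 1 := by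
    rw [Matrix.mul_assoc, ← hBC, ← Matrix.mul_assoc]
    exact h2
  have hBA : B * (r • (1 + Jm N)) = 1 := mul_eq_one_comm.1 hAB
  calc Cᵀ * C = Cᵀ * C * (B * (r • (1 + Jm N))) := by rw [hBA, Matrix.mul_one]
    _ = (Cᵀ * C * B) * (r • (1 + Jm N)) := (Matrix.mul_assoc _ _ _).symm
    _ = r • (1 + Jm N) := by rw [h3, Matrix.one_mul]

variable {p : ℕ} [NeZero p]

/-- the orbit matrix over `ℚ` -/
def omQ (D : LiftData N p) : Matrix (Fin N) (Fin N) ℚ := Matrix.of fun s t => (D.om s t : ℚ)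

/-- `m(m−1) + m = m²` in `ℕ` -/
theorem mul_pred_add_self (m : ℕ) : m * (m - 1) + m = m * m := by
  rcases m with _ | m
  · simp
  · rw [Nat.add_sub_cancel]; ring

/-- the row equations in matrix form: `C Cᵀ = (p−1)(I + J)` -/
theorem omQ_mul_transpose (D : LiftData N p) (hV : D.Valid) : D.omQ * (D.omQ)ᵀ = ((p : ℚ) - 1) • (1 + Jm N) := by
  obtain ⟨hrow, hint, hcross, -⟩ := D.om_equations hV
  have hp1 : ((p - 1 : ℕ) : ℚ) = (p : ℚ) - 1 := by
    have : 1 ≤ p := Nat.pos_of_ne_zero (NeZero.ne p)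
    push_cast [Nat.cast_sub this]; ring
  ext s s'
  simp only [Matrix.mul_apply, Matrix.transpose_apply, omQ, Matrix.of_apply, Matrix.smul_apply, Matrix.add_apply, Matrix.one_apply, Jm_apply,
    smul_eq_mul]
  by_cases hss : s = s'
  · subst hss
    simp only [if_true]
    have e : ∑ t, (D.om s t : ℚ) * (D.om s t : ℚ) = 2 * ((p : ℚ) - 1) := by
      have h1 := hint s
      have h2 := hrow s
      have hsum : ∑ t, D.om s t * D.om s t = ∑ t, D.om s t * (D.om s t - 1) + ∑ t, D.om s t := by
        rw [← Finset.sum_add_distrib]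
        exact Finset.sum_congr rfl fun t _ => (mul_pred_add_self _).symm
      rw [h1, h2] at hsum
      have := congrArg (fun n : ℕ => (n : ℚ)) hsum
      push_cast at this
      rw [this, hp1]; ring
    rw [e]; ring
  · simp only [hss, if_false]
    have := congrArg (fun n : ℕ => (n : ℚ)) (hcross s s' hss)
    push_cast at this
    rw [this, hp1]; ring

/-- row sums in matrix form: `C J = (p−1) J` -/
theorem omQ_mul_Jm (D : LiftData N p) (hV : D.Valid) : D.omQ * Jm N = ((p : ℚ) - 1) • Jm N := by
  obtain ⟨hrow, -, -, -⟩ := D.om_equations hV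
  have h1p : 1 ≤ p := Nat.pos_of_ne_zero (NeZero.ne p)
  ext s t
  simp only [Matrix.mul_apply, omQ, Matrix.of_apply, Jm_apply, mul_one, Matrix.smul_apply, smul_eq_mul]
  have e := congrArg (fun n : ℕ => (n : ℚ)) (hrow s)
  push_cast [Nat.cast_sub h1p] at e
  exact e

/-- column sums in matrix form: `J C = (p−1) J` -/
theorem Jm_mul_omQ (D : LiftData N p) (hV : D.Valid) : Jm N * D.omQ = ((p : ℚ) - 1) • Jm N := by
  obtain ⟨-, -, -, hcol⟩ := D.om_equations hV
  have h1p : 1 ≤ p := Nat.pos_of_ne_zero (NeZero.ne p)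
  ext s t
  simp only [Matrix.mul_apply, omQ, Matrix.of_apply, Jm_apply, one_mul, Matrix.smul_apply, smul_eq_mul, mul_one]
  have e := congrArg (fun n : ℕ => (n : ℚ)) (hcol t)
  push_cast [Nat.cast_sub h1p] at e
  exact e

/-- **the column Gram equations of valid lift data** (`2 ≤ p`): `Σ_s m_{s,t}² = 2(p−1)` and `Σ_s m_{s,t} m_{s,t'} = p − 1` for `t ≠ t'` -/
theorem om_col_equations (D : LiftData N p) (hV : D.Valid) (hp : 2 ≤ p) :
    (∀ t, ∑ s, D.om s t * D.om s t = 2 * (p - 1)) ∧ (∀ t t', t ≠ t' → ∑ s, D.om s t * D.om s t' = p - 1) := by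
  have hr : ((p : ℚ) - 1) ≠ 0 := by
    have : (2 : ℚ) ≤ (p : ℚ) := by exact_mod_cast hp
    intro h; linarith
  have hG := gram_transpose hr (D.omQ_mul_transpose hV) (D.omQ_mul_Jm hV) (D.Jm_mul_omQ hV)
  have h1p : 1 ≤ p := le_trans (by norm_num) hp
  have entry : ∀ t t', (∑ s, (D.om s t : ℚ) * (D.om s t' : ℚ)) = ((p : ℚ) - 1) * ((if t = t' then 1 else 0) + 1) := by
    intro t t'
    have := congrArg (fun M => M t t') hG
    simpa only [Matrix.mul_apply, Matrix.transpose_apply, omQ, Matrix.of_apply, Matrix.smul_apply, Matrix.add_apply, Matrix.one_apply, Jm_apply,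
      smul_eq_mul] using this
  constructor
  · intro t
    have e := entry t t
    simp only [if_true] at e
    have : ((∑ s, D.om s t * D.om s t : ℕ) : ℚ) = ((2 * (p - 1) : ℕ) : ℚ) := by push_cast [Nat.cast_sub h1p]; rw [e]; ring
    exact_mod_cast this
  · intro t t' htt
    have e := entry t t'
    simp only [htt, if_false, zero_add, mul_one] at e
    have : ((∑ s, D.om s t * D.om s t' : ℕ) : ℚ) = ((p - 1 : ℕ) : ℚ) := by push_cast [Nat.cast_sub h1p]; rw [e]
    exact_mod_cast this

end LiftData

end Summit.Ventures.DiscreteObjects.PP12
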